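import Literature.NumberTheory.Automorphic.Liu2021.AppendixC.DefC1toC3
import Mathlib.RingTheory.Norm.Defs
import Mathlib.LinearAlgebra.Matrix.Determinant.Basic
import HarnessLib

/-!
# Rapoport–Smithling–Zhang 2020, Appendix A «Sign invariants» — statement carpet

M. Rapoport, B. Smithling, W. Zhang, *Arithmetic diagonal cycles on unitary Shimura varieties*, Compositio Math. 156 (2020)
= arXiv 1710.06962 v6 [RapoportSmithlingZhang2020Diagonal], Appendix A, v6 pp. 54–58 (source of record: the cell's v6 page
text `F0/P6/lit1/RSZ2020-v6-pages.txt` + item map 15cc0883; «p. N» = arXiv v6 page). Carpet-typing squad TKR (cell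
hodgecm-mathlib, seat TKR-t05, third block): STATEMENTS ONLY — definitions with bodies and (here) one small named fact; no
proof, no `sorry`, no `axiom`, no `instance`, no notation.

Notation of the print: `F/ℚ` a CM field, `F₀` its maximal totally real subfield, `Φ` a CM type for `F`, `v` a finite place of
`F₀` non-split in `F`; here `(F₀, F)` are the variables `(F₀ F)` and the embedding bookkeeping is the tree's: CM types
★ `Literature.AlgebraicGeometry.Motives.CMType F` (sets of embeddings `F →+* ℂ` with exactly one of each conjugate pair), the
`Gal(ℂ/ℚ)`-action on embeddings and on `ℕ[Hom(F, ℂ)]` and its stabilizers ★ `Liu2021.AppendixC.galAct ∕ stabilizer`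
(scoped instances of `Literature/NumberTheory/Automorphic/Liu2021/AppendixC/DefC1toC3`), reflex fields as fixed fields in `ℂ`
(★ `HermSpace.reflexField` style; the print's `ℚ̄` is read inside `ℂ`).

## The print (verbatim extracts, v6 pp. 54–58) and what is TYPED

* p. 54: «we adapt the sign invariants of [32] to the setting of the moduli problems introduced in Sections 4 and 5 […] We
  are first going to define an invariant (A.1) `inv_v(A₀, ι₀, λ₀, A, ι, λ)^♮ ∈ F₀,v^×/Nm F_v^×` attached to […] abelian varieties
  `A₀` and `A` over `k` of respective dimensions `d` and `nd`; rational actions `ι₀ : F → End°(A₀)` and `ι : F → End°(A)`; and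
  quasi-polarizations […]. We will then write (A.2) `inv_v(…) ∈ {±1}` for the image […] under the identification
  `F₀,v^×/Nm F_v^× ≃ {±1}`.»  (p. 55, case (a)) «`V_ℓ(A₀, A) := Hom_F(V_ℓ(A₀), V_ℓ(A))` […] `h(φ₁, φ₂) := λ₀⁻¹ ∘ φ₂^∨ ∘ λ ∘ φ₁`
  […] we define the invariant at `v` as for any `n`-dimensional `F_v/F₀,v`-hermitian space in the main body of the paper (1.4),
  `inv_v(…)^♮ := (-1)^{n(n-1)/2} det V_v(A₀, A) ∈ F₀,v^×/Nm F_v^×`» → `InvIsOne` (the class `(-1)^{n(n-1)/2} det` of a hermitian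
  Gram matrix is a norm, i.e. the invariant is `+1`; the attachment to `(A₀, A)` through Tate ∕ Dieudonné modules is NOT typed).
* p. 55: «let `r : Hom_ℚ(F, ℚ̄) → ℤ_{≥0}` be a generalized CM type for `F` of rank `n`, i.e., a function `φ ↦ r_φ` satisfying
  `r_φ + r_φ̄ = n` for all `φ`» → `IsGeneralizedCMType`; «(A.3) let `r₀` be the opposite of the canonical generalized CM type for
  `F` of rank one attached to the CM type `Φ`, `r₀,φ = 0, φ ∈ Φ; 1, φ ∉ Φ`» → `oppositeCanonical` (and Remark A.2's
  `canonicalRankOne`); «(A.4) Let `E` be the subfield of `ℚ̄` characterized by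
  `Gal(ℚ̄/E) = {σ ∈ Gal(ℚ̄/ℚ) ∣ σΦ = Φ and r_{σφ} = r_φ for all φ}`. Thus `E` is the join of the reflex fields of `r` and of
  `r₀`» → `indicatorElt`, `typeElt`, `reflexStabilizer`, `reflexFieldJoin`.
* p. 56: «(A.6) […] (A.7) `sgn(r_{ν,v}) := (-1)^{Σ_{φ ∈ Φ_{ν,v}} r_φ}` and (A.8) `inv^r_v(…) := sgn(r_{ν,v})·inv_v(…)`» → `sgn`,
  `AdjustedInvIsOne`; (A.5) (`inv^r_v := inv_v` when `reschar v ≠ char k`) is the case `Φ_{ν,v} = ∅` of the same definition.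
  **Prop. A.1** «for every non-archimedean place `v` […] the function `s ↦ inv^r_v(A₀,s, …, λ_s)` is constant on `S`» — NOT
  typed (families of abelian schemes over a connected base; no carrier).
* p. 58: «(A.10) `cl(N^{Frob=1}_{ℚ,v}, S_v) = μ^♯ = Σ_{φ ∈ Ψ_v} μ_φ`» with «`μ_φ = n r₀,φ - r_φ`» (p. 57) under
  `X_*(T)_Γ ≅ H¹(ℚ_p, T) ≅ ℤ/2ℤ` → `classA10` (the element of `ℤ/2ℤ`; the `p`-adic Hodge theory (A.9) is NOT typed).
  Remark A.2 «we could have instead worked with respect to the canonical function (sending `φ ↦ 1` for `φ ∈ Φ` and `φ ↦ 0` for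
  `φ ∈ Φ̄`), which is tantamount to replacing `Φ` by `Φ̄`. In this case one defines the `r`-adjusted invariant […] to be
  `(-1)^{Σ_{φ ∈ Φ̄_v} r_φ}·inv_v(…)`» → `canonicalRankOne` and the bookkeeping fact `RSZ2020_A_2_sgn_conj` (the two signs differ
  by `(-1)^{n·|Φ_v|}` for a generalized CM type of rank `n`).  Remark A.3 ∕ (A.11) (the variant for `p`-divisible groups,
  `inv^{r_L} := sgn(r_L)·inv`) has the same shape `AdjustedInvIsOne`; its objects (`p`-divisible groups with `O_L`-action) are
  NOT typed.

ED. 2 (squad lead's follow-up F-2): Prop. A.1 as a SHAPE ROW `RSZ2020_A_1` over a posited ⟨CARRIER⟩ `AppAFamilyData` (points of the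
connected base, places, `inv_v` and `sgn` at each point; `invR` = (A.8)), and REAL defs for the value group «`F₀,v^×/Nm F_v^×`»
(`NormResidueGroup`) and the torus `T = ker(Nm)` of p. 57 (`normOneTorusPoints`).

## References

* [RapoportSmithlingZhang2020Diagonal] App. A, v6 pp. 54–58; §1 (1.4) p. 5 (the invariant of a hermitian space).
* [Liu2021] App. C (the tree's embedding ∕ stabilizer ∕ reflex-field vocabulary reused here).
-/

noncomputable section

namespace Literature.AlgebraicGeometry.ShimuraVarieties.RapoportSmithlingZhang2020.AppASignInvariants

open _root_.NumberField
open Literature.AlgebraicGeometry.Motives (CMType)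
open Literature.NumberTheory.Automorphic.Liu2021.AppendixC

variable (F₀ F : Type) [Field F₀] [NumberField F₀] [IsTotallyReal F₀] [Field F] [NumberField F] [Algebra F₀ F]
  [IsTotallyComplex F] [Algebra.IsQuadraticExtension F₀ F]

/-! ## Generalized CM types, `r₀`, and the field `E` of (A.4) (v6 p. 55) -/

/-- «a generalized CM type for `F` of rank `n`, i.e., a function `φ ↦ r_φ` satisfying `r_φ + r_φ̄ = n` for all
`φ ∈ Hom_ℚ(F, ℚ̄)`» (p. 55, cf. [32, Def. 2.1]); embeddings into `ℂ`, `φ̄` = Mathlib `ComplexEmbedding.conjugate φ`.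
[cite: RapoportSmithlingZhang2020Diagonal, App. A p. 55] -/
def IsGeneralizedCMType (n : ℕ) (r : (F →+* ℂ) → ℕ) : Prop :=
  ∀ φ : F →+* ℂ, r φ + r (NumberField.ComplexEmbedding.conjugate φ) = n

/-- (A.3) «let `r₀` be the opposite of the canonical generalized CM type for `F` of rank one attached to the CM type `Φ`,
`r₀,φ = 0` for `φ ∈ Φ`, `1` for `φ ∉ Φ`» (p. 55). [cite: RapoportSmithlingZhang2020Diagonal, App. A (A.3) p. 55] -/
def oppositeCanonical (Φ : CMType F) : (F →+* ℂ) → ℕ := (Φ.1ᶜ).indicator fun _ => 1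

/-- Remark A.2 «the canonical function (sending `φ ↦ 1` for `φ ∈ Φ` and `φ ↦ 0` for `φ ∈ Φ̄`)» (p. 58).
[cite: RapoportSmithlingZhang2020Diagonal, App. A Remark A.2 p. 58] -/
def canonicalRankOne (Φ : CMType F) : (F →+* ℂ) → ℕ := Φ.1.indicator fun _ => 1

/-- A function `r : Hom(F, ℂ) → ℤ_{≥0}` as an element of `ℕ[Hom(F, ℂ)]` (finitely many embeddings), so that the tree's
`Gal(ℂ/ℚ)`-action ★ `galActElt` and ★ `stabilizer` apply: «`r_{σφ} = r_φ` for all `φ`» is `σ ∈ stabilizer (typeElt r)`.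
[cite: RapoportSmithlingZhang2020Diagonal, App. A (A.4) p. 55] -/
def typeElt (r : (F →+* ℂ) → ℕ) : (F →+* ℂ) →₀ ℕ := Finsupp.equivFunOnFinite.symm r

/-- The CM type `Φ` as the element `Σ_{φ ∈ Φ} φ` of `ℕ[Hom(F, ℂ)]`: «`σΦ = Φ`» is `σ ∈ stabilizer (indicatorElt Φ)`.
[cite: RapoportSmithlingZhang2020Diagonal, App. A (A.4) p. 55] -/
def indicatorElt (Φ : CMType F) : (F →+* ℂ) →₀ ℕ := Finsupp.equivFunOnFinite.symm (Φ.1.indicator fun _ => 1)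

/-- (A.4) «`Gal(ℚ̄/E) = {σ ∈ Gal(ℚ̄/ℚ) ∣ σΦ = Φ and r_{σφ} = r_φ for all φ ∈ Hom_ℚ(F, ℚ̄)}`» (p. 55), as a subgroup of
`Gal(ℂ/ℚ) = ℂ ≃ₐ[ℚ] ℂ` (the tree's ★ `stabilizer`, intersected). [cite: RapoportSmithlingZhang2020Diagonal, App. A (A.4) p. 55] -/
def reflexStabilizer (Φ : CMType F) (r : (F →+* ℂ) → ℕ) : Subgroup (ℂ ≃ₐ[ℚ] ℂ) :=
  stabilizer F (indicatorElt F Φ) ⊓ stabilizer F (typeElt F r)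

/-- (A.4) «Let `E` be the subfield of `ℚ̄` characterized by `Gal(ℚ̄/E) = {σ ∣ σΦ = Φ and r_{σφ} = r_φ}` […] Thus `E` is the join
of the reflex fields of `r` and of `r₀`» (pp. 55–56): the fixed field of `reflexStabilizer Φ r` in `ℂ` (the print's `ℚ̄` read
inside `ℂ`, as in ★ `HermSpace.reflexField`). [cite: RapoportSmithlingZhang2020Diagonal, App. A (A.4) p. 55] -/
def reflexFieldJoin (Φ : CMType F) (r : (F →+* ℂ) → ℕ) : IntermediateField ℚ ℂ :=
  IntermediateField.fixedField (reflexStabilizer F Φ r)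

/-! ## The invariant of a hermitian space and its `r`-adjustment (v6 pp. 55–56, 58) -/

/-- «the invariant […] as for any `n`-dimensional `F_v/F₀,v`-hermitian space in the main body of the paper (1.4),
`inv(V) := (-1)^{n(n-1)/2} det V ∈ F₀,v^×/Nm F_v^×`, where `det` is the class mod `Nm F_v^×` of any hermitian matrix
representing» the form (p. 55, case (a); (A.1)–(A.2) p. 54) — typed for a quadratic algebra `L/L₀` and a Gram matrix `H` over
`L` as the proposition «the invariant is `+1`», i.e. `(-1)^{n(n-1)/2} det H` is a norm from `L^×` (`Algebra.norm L₀`). Under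
«`F₀,v^×/Nm F_v^× ≃ {±1}`» its negation is «the invariant is `-1`». [cite: RapoportSmithlingZhang2020Diagonal, App. A (A.1)–(A.2) pp. 54–55] -/
def InvIsOne (L₀ L : Type) [Field L₀] [Field L] [Algebra L₀ L] {n : ℕ} (H : Matrix (Fin n) (Fin n) L) : Prop :=
  ∃ y : L, y ≠ 0 ∧ (-1 : L) ^ (n * (n - 1) / 2) * H.det = algebraMap L₀ L (Algebra.norm L₀ y)

/-- (A.7) «`sgn(r_{ν,v}) := (-1)^{Σ_{φ ∈ Φ_{ν,v}} r_φ}`» (p. 56), for a finite set `Φ_{ν,v}` of embeddings and `r`; also Remark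
A.3 (A.11) `sgn(r_L)` and [cite context] Remark 8.18's `sgn(r_L) = (-1)^{Σ_{φ ∈ Φ_L} (r_L)_φ}`. [cite: RapoportSmithlingZhang2020Diagonal, App. A (A.7) p. 56] -/
def sgn {ι : Type} (Φv : Finset ι) (r : ι → ℕ) : ℤˣ := (-1) ^ (∑ φ ∈ Φv, r φ)

/-- (A.8) «`inv^r_v(…) := sgn(r_{ν,v})·inv_v(…)`» (p. 56) — with both signs read as `±1`: the `r`-adjusted invariant is `+1`
iff `sgn(r_{ν,v}) = 1 ↔ inv_v = +1`; for `Φ_{ν,v} = ∅` (residue characteristic of `v` ≠ `char k`, (A.5)) it is `inv_v`.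
(A.11) of Remark A.3 has the same shape. [cite: RapoportSmithlingZhang2020Diagonal, App. A (A.8) p. 56] -/
def AdjustedInvIsOne (L₀ L : Type) [Field L₀] [Field L] [Algebra L₀ L] {ι : Type} (Φv : Finset ι) (r : ι → ℕ) {n : ℕ}
    (H : Matrix (Fin n) (Fin n) L) : Prop :=
  sgn Φv r = 1 ↔ InvIsOne L₀ L H

/-- (A.10) «`cl(N^{Frob=1}_{ℚ,v}, S_v) = μ^♯ = Σ_{φ ∈ Ψ_v} μ_φ`» in `X_*(T)_Γ ≅ H¹(ℚ_p, T) ≅ ℤ/2ℤ` (p. 58), with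
«`μ_φ = n r₀,φ - r_φ`» (p. 57), `Ψ_v` any half-system: the resulting class in `ℤ/2ℤ`. [cite: RapoportSmithlingZhang2020Diagonal, App. A (A.10) p. 58] -/
def classA10 {ι : Type} (n : ℕ) (Ψv : Finset ι) (r₀ r : ι → ℕ) : ZMod 2 :=
  ∑ φ ∈ Ψv, (((n * r₀ φ : ℕ) : ℤ) - (r φ : ℤ) : ZMod 2)

/-- Remark A.2 (p. 58): working with the canonical function instead of its opposite «is tantamount to replacing `Φ` by `Φ̄`», the
adjusted invariant becoming `(-1)^{Σ_{φ ∈ Φ̄_v} r_φ}·inv_v`. Bookkeeping behind «the statement and proof of Proposition A.1 for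
this version go through virtually without change»: for a generalized CM type `r` of rank `n` and a finite set `Φ_v` of
embeddings, the two signs `(-1)^{Σ_{Φ_v} r_φ}` and `(-1)^{Σ_{Φ̄_v} r_φ} = (-1)^{Σ_{Φ_v} r_φ̄}` differ by the constant
`(-1)^{n·|Φ_v|}`.
[cite: RapoportSmithlingZhang2020Diagonal, App. A Remark A.2 p. 58] -/
def RSZ2020_A_2_sgn_conj : Prop :=
  ∀ (n : ℕ) (r : (F →+* ℂ) → ℕ), IsGeneralizedCMType F n r → ∀ Φv : Finset (F →+* ℂ),
    sgn Φv r * sgn Φv (fun φ => r (NumberField.ComplexEmbedding.conjugate φ)) = (-1) ^ (n * Φv.card)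

/-! ## ED. 2 — Prop. A.1 as a SHAPE row; the torus `T` and `F₀,v^×/Nm F_v^×` (v6 pp. 56–57) -/

/-- The value group of the invariant (A.1), «`F₀,v^×/Nm F_v^×`» (p. 54), and (p. 57) «`H¹(ℚ_p, T) = F₀,v^×/Nm F_v^×`», for a
quadratic algebra `L/L₀` (`F_v/F₀,v`): the units of `L₀` modulo norms of units of `L` (Mathlib `Algebra.norm`). For a
non-split non-archimedean `v` this group «`≃ {±1}`» (A.2).  An `abbrev`, so that Mathlib's `Group` structure of the quotient of the
commutative group `L₀ˣ` by a subgroup is found by instance resolution; the additive twin `Additive Kˣ ⧸ LinearMap.range (unitsNorm K L)`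
(«`H²(Gal, Lˣ) ≅ Kˣ/N Lˣ`») lives in the tree's `Literature/Algebra/Homology/CyclicExtensionUnitsCohomology.lean`.
[cite: RapoportSmithlingZhang2020Diagonal, App. A (A.1)–(A.2) p. 54] -/
abbrev NormResidueGroup (L₀ L : Type) [Field L₀] [Field L] [Algebra L₀ L] : Type :=
  L₀ˣ ⧸ MonoidHom.range (Units.map (Algebra.norm L₀ : L →* L₀))

/-- (p. 57) «let `T` be the torus over `ℚ_p` which is the kernel in the exact sequence
`1 → T → Res_{F_v/ℚ_p} 𝔾_m → Res_{F₀,v/ℚ_p} 𝔾_m → 1`» (the norm map): its group of rational points, the norm-one units of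
`L = F_v` over `L₀ = F₀,v`. [cite: RapoportSmithlingZhang2020Diagonal, App. A p. 57] -/
def normOneTorusPoints (L₀ L : Type) [Field L₀] [Field L] [Algebra L₀ L] : Subgroup Lˣ :=
  MonoidHom.ker (Units.map (Algebra.norm L₀ : L →* L₀))

/-- ⟨CARRIER⟩ for **Prop. A.1** (p. 56), whose objects (a tuple `(A₀, ι₀, λ₀, A, ι, λ) ∈ M_{r₀,r}(S)` over a CONNECTED
`O_E`-scheme `S`, its fibres at the points `s` of `S`, the Tate ∕ Dieudonné modules computing `inv_v`) have no carrier in the tree: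
posited data recording only what the Proposition quantifies over — the points of the connected base, the non-archimedean places
`v` of `F₀` non-split in `F`, and at each `(v, s)` the invariant `inv_v(A₀,s, ι₀,s, λ₀,s, A_s, ι_s, λ_s) ∈ {±1}` of (A.1)–(A.2) and
the sign `sgn(r_{ν(s),v})` of (A.7) (`= 1` when `reschar v ≠ char κ(s)`, (A.5)). REAL content lives in `InvIsOne` ∕ `sgn` above;
nothing is asserted by the structure. [cite: RapoportSmithlingZhang2020Diagonal, App. A Prop. A.1 p. 56] -/
structure AppAFamilyData : Type 1 where
  /-- the points `s` of the connected base scheme `S` over `Spec O_E` -/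
  Pt : Type
  /-- «`S` is a connected scheme»: recorded as non-emptiness of the point set used below (the topology is not modelled) -/
  nonempty_Pt : Nonempty Pt
  /-- the non-archimedean places `v` of `F₀` which are non-split in `F` -/
  Place : Type
  /-- `inv_v` of the fibre at `s`, (A.1)–(A.2), valued in `{±1}` -/
  inv : Place → Pt → ℤˣ
  /-- `sgn(r_{ν(s),v})` at `s`, (A.7); `1` in the case (A.5) -/
  sgn : Place → Pt → ℤˣ

/-- The `r`-adjusted invariant (A.8) `inv^r_v := sgn(r_{ν,v})·inv_v` of the fibre at `s`, on the carrier.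
[cite: RapoportSmithlingZhang2020Diagonal, App. A (A.8) p. 56] -/
def AppAFamilyData.invR (D : AppAFamilyData) (v : D.Place) (s : D.Pt) : ℤˣ := D.sgn v s * D.inv v s

/-- **Prop. A.1** (p. 56) «Let `(A₀, ι₀, λ₀, A, ι, λ) ∈ M_{r₀,r}(S)`, where `S` is a connected scheme over `Spec O_E`. Then for every
non-archimedean place `v` of `F₀` which is non-split in `F`, the function `s ↦ inv^r_v(A₀,s, ι₀,s, λ₀,s, A_s, ι_s, λ_s)` is constant
on `S`» — SHAPE ROW over the posited carrier `AppAFamilyData` (a predicate on the datum; the content is the citation, nothing in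
this file claims it). [cite: RapoportSmithlingZhang2020Diagonal, App. A Prop. A.1 p. 56] -/
def RSZ2020_A_1 (D : AppAFamilyData) : Prop :=
  ∀ (v : D.Place) (s s' : D.Pt), D.invR v s = D.invR v s'

end Literature.AlgebraicGeometry.ShimuraVarieties.RapoportSmithlingZhang2020.AppASignInvariants

end
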